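import Summits.Ventures.PercRepro.C025ProfilePLDClosureArith

/-!
# THE PLANE U_{3,m} FOR EVERY m ≥ m₀ FROM THE CASE m = m₀ AND ONE PRESERVER: THE ARITHMETIC (night-3 g31)

`proofs/NIGHT3-G31-TWOLIFT.md` §5.  The profile of `U_{3,m}`, `m ≥ 5`, is `T₀₃ + m·T₁₃ + C(m,2)·T₂₃ + c_m·δ₃₃` with
`c_m = Σ_{3 ≤ i ≤ m−3} C(m,i)` (`sum_choose_min_three`), `m ↦ c_m` non-decreasing (`sum_choose_mid3_mono`).  `T₂₃` (the pairs
`(x+2, f+3), (x+3, f+2)` = `PLDClosure.coloop` after `shift11` twice) and `δ₃₃` (`shift11` three times) preserve PER-LAYER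
DOMINANCE at the array level (g29); `T₁₃` alone does not, but `q := 2·T₁₃ + 8·T₂₃` does at bounded rank (a certificate table,
`PLDPlaneTable.pld_conv_q3b4_of_eRank_le_5`).  Since `2·(U_{3,m} − U_{3,m₀}) = (m−m₀)·q + (m−m₀)(m+m₀−9)·T₂₃ + 2(c_m−c_{m₀})·δ₃₃`
for `5 ≤ m₀ ≤ m`, every (PLD) instance of the family convolved with `U_{3,m}` follows from the same instance for `U_{3,m₀}`
and the `q`-instance (`lift_instance_plane`).  No `def`, no `instance`, no notation.  Axioms: standard.
-/

namespace PercRepro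

open Finset

namespace PLDPlaneLift

variable {ι : Type}

/-- The uniform profile of `U_{3,m}`, `m ≥ 5`. -/
theorem sum_choose_min_three (m : ℕ) (hm : 5 ≤ m) (g : ℕ → ℕ → ℕ) :
    ∑ i ∈ range (m + 1), m.choose i * g (min i 3) (min (m - i) 3) =
      g 0 3 + m * g 1 3 + m.choose 2 * g 2 3 + (∑ i ∈ Ico 3 (m - 2), m.choose i) * g 3 3 +
        m.choose 2 * g 3 2 + m * g 3 1 + g 3 0 := by
  obtain ⟨k, rfl⟩ : ∃ k, m = k + 5 := ⟨m - 5, by omega⟩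
  rw [sum_range_succ, sum_range_succ, sum_range_succ, sum_range_succ', sum_range_succ', sum_range_succ']
  have hmid : ∀ i ∈ range k, (k + 5).choose (i + 1 + 1 + 1) * g (min (i + 1 + 1 + 1) 3) (min (k + 5 - (i + 1 + 1 + 1)) 3) =
      (k + 5).choose (i + 1 + 1 + 1) * g 3 3 := by
    intro i hi
    rw [mem_range] at hi
    rw [show min (i + 1 + 1 + 1) 3 = 3 by omega, show min (k + 5 - (i + 1 + 1 + 1)) 3 = 3 by omega]
  rw [sum_congr rfl hmid, ← sum_mul, show k + 5 - 2 = k + 3 by omega, sum_Ico_eq_sum_range,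
    show k + 3 - 3 = k by omega]
  have hc : ∑ i ∈ range k, (k + 5).choose (3 + i) = ∑ i ∈ range k, (k + 5).choose (i + 1 + 1 + 1) :=
    sum_congr rfl fun i _ => by rw [show 3 + i = i + 1 + 1 + 1 by omega]
  have h1 : (k + 5).choose (0 + 1) = k + 5 := Nat.choose_one_right _
  have h2 : (k + 5).choose (k + 4) = k + 5 := Nat.choose_succ_self_right (k + 4)
  have h3 : (k + 5).choose (k + 3) = (k + 5).choose 2 := by
    rw [← Nat.choose_symm (by omega : 2 ≤ k + 5), show k + 5 - 2 = k + 3 by omega]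
  rw [hc, Nat.choose_zero_right, Nat.choose_self, h1, h2, h3]
  simp only [show min (0 + 1) 3 = 1 by omega, show min (k + 4) 3 = 3 by omega, show min 0 3 = 0 by omega,
    show k + 5 - 0 = k + 5 by omega, show min (k + 5) 3 = 3 by omega, show k + 5 - (k + 4) = 1 by omega,
    show k + 5 - (k + 5) = 0 by omega, show min (0 + 1 + 1) 3 = 2 by omega, show min (k + 3) 3 = 3 by omega,
    show k + 5 - (k + 3) = 2 by omega, show min (k + 5 - (0 + 1)) 3 = 3 by omega, one_mul]
  ring

/-- `c_{m₀} ≤ c_m` for `m₀ ≤ m`. -/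
theorem sum_choose_mid3_mono (m₀ m : ℕ) (hm : m₀ ≤ m) :
    ∑ i ∈ Ico 3 (m₀ - 2), m₀.choose i ≤ ∑ i ∈ Ico 3 (m - 2), m.choose i := by
  calc ∑ i ∈ Ico 3 (m₀ - 2), m₀.choose i ≤ ∑ i ∈ Ico 3 (m₀ - 2), m.choose i :=
        sum_le_sum fun i _ => Nat.choose_le_choose i hm
    _ ≤ ∑ i ∈ Ico 3 (m - 2), m.choose i :=
        sum_le_sum_of_subset_of_nonneg (Ico_subset_Ico le_rfl (by omega)) fun _ _ _ => Nat.zero_le _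

/-- `2·C(m,2) = m·(m−1)`. -/
theorem two_mul_choose_two (m : ℕ) : 2 * m.choose 2 = m * (m - 1) := by
  rw [Nat.choose_two_right, Nat.two_mul_div_two_of_even (Nat.even_mul_pred_self m)]

/-- `2·(C(m,2) − C(m₀,2)) = (m − m₀)·(m + m₀ − 1)` for `m₀ ≤ m`, subtraction-free. -/
theorem two_mul_choose_two_sub (m₀ m : ℕ) (hm : m₀ ≤ m) :
    2 * m.choose 2 = 2 * m₀.choose 2 + (m - m₀) * (m + m₀ - 1) := by
  obtain ⟨k, rfl⟩ := Nat.exists_eq_add_of_le hm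
  rw [two_mul_choose_two, two_mul_choose_two, Nat.add_sub_cancel_left]
  rcases m₀ with _ | n
  · simp only [zero_add, Nat.zero_mul, add_zero]
  · rw [show n + 1 + k - 1 = n + k by omega, show n + 1 - 1 = n by omega, show n + 1 + k + (n + 1) - 1 = n + k + n + 1 by omega]
    ring

/-- The linear algebra of the plane lift, with the fourteen layer sums and the coefficients abstracted:
`2·C = 2·C₀ + k·(9 + u)` (= `two_mul_choose_two_sub` with `m = m₀ + k`, `m + m₀ − 1 = 9 + u`). -/
theorem lift_alg (a03 a13 a23 a33 a32 a31 a30 b03 b13 b23 b33 b32 b31 b30 m₀ k k' u C C₀ c₀ : ℕ)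
    (hC : 2 * C = 2 * C₀ + k * (9 + u))
    (h₀ : a03 + m₀ * a13 + C₀ * a23 + c₀ * a33 + C₀ * a32 + m₀ * a31 + a30 ≤
      b03 + m₀ * b13 + C₀ * b23 + c₀ * b33 + C₀ * b32 + m₀ * b31 + b30)
    (hq : 2 * a13 + 2 * a31 + 8 * a23 + 8 * a32 ≤ 2 * b13 + 2 * b31 + 8 * b23 + 8 * b32)
    (hT : a23 + a32 ≤ b23 + b32) (hS : a33 ≤ b33) :
    a03 + (m₀ + k) * a13 + C * a23 + (c₀ + k') * a33 + C * a32 + (m₀ + k) * a31 + a30 ≤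
      b03 + (m₀ + k) * b13 + C * b23 + (c₀ + k') * b33 + C * b32 + (m₀ + k) * b31 + b30 := by
  have e1 : 2 * C * a23 = (2 * C₀ + k * (9 + u)) * a23 := by rw [hC]
  have e2 : 2 * C * a32 = (2 * C₀ + k * (9 + u)) * a32 := by rw [hC]
  have e3 : 2 * C * b23 = (2 * C₀ + k * (9 + u)) * b23 := by rw [hC]
  have e4 : 2 * C * b32 = (2 * C₀ + k * (9 + u)) * b32 := by rw [hC]
  have hqk := Nat.mul_le_mul_left k hq
  have hT1 := Nat.mul_le_mul_left k hT
  have hT2 := Nat.mul_le_mul_left (k * u) hT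
  have hSk := Nat.mul_le_mul_left k' hS
  nlinarith [e1, e2, e3, e4, hqk, hT1, hT2, hSk, h₀]

/-- THE LIFT IN `m` FOR PLANES: for a family `(s, x, f)` with (PLD), `5 ≤ m₀ ≤ m`, an admissible `(lo, hi, δ, Θ)`, the
`q`-instance (`q = 2·T₁₃ + 8·T₂₃`) and the `U_{3,m₀}`-instance give the `U_{3,m}`-instance. -/
theorem lift_instance_plane (s : Finset ι) (x f : ι → ℕ)
    (hPLD : ∀ lo hi δ Θ : ℕ, Θ ≤ lo + hi + δ → (lo = 0 ∨ lo + hi + δ ≤ Θ) →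
      ∑ i ∈ s, (if lo ≤ x i ∧ x i ≤ hi ∧ Θ ≤ f i + x i then (f i).choose δ else 0) ≤
        ∑ i ∈ s, (if lo + δ ≤ f i ∧ f i ≤ hi + δ then (f i).choose δ else 0))
    (m₀ m : ℕ) (hm₀ : 5 ≤ m₀) (hm : m₀ ≤ m) (lo hi δ Θ : ℕ) (hΘ : Θ ≤ lo + hi + δ)
    (hlo : lo = 0 ∨ lo + hi + δ ≤ Θ)
    (hq : ∑ i ∈ s, (2 * (if lo ≤ x i + 1 ∧ x i + 1 ≤ hi ∧ Θ ≤ (f i + 3) + (x i + 1) then (f i + 3).choose δ else 0) +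
        2 * (if lo ≤ x i + 3 ∧ x i + 3 ≤ hi ∧ Θ ≤ (f i + 1) + (x i + 3) then (f i + 1).choose δ else 0) +
        8 * (if lo ≤ x i + 2 ∧ x i + 2 ≤ hi ∧ Θ ≤ (f i + 3) + (x i + 2) then (f i + 3).choose δ else 0) +
        8 * (if lo ≤ x i + 3 ∧ x i + 3 ≤ hi ∧ Θ ≤ (f i + 2) + (x i + 3) then (f i + 2).choose δ else 0)) ≤
      ∑ i ∈ s, (2 * (if lo + δ ≤ f i + 3 ∧ f i + 3 ≤ hi + δ then (f i + 3).choose δ else 0) +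
        2 * (if lo + δ ≤ f i + 1 ∧ f i + 1 ≤ hi + δ then (f i + 1).choose δ else 0) +
        8 * (if lo + δ ≤ f i + 3 ∧ f i + 3 ≤ hi + δ then (f i + 3).choose δ else 0) +
        8 * (if lo + δ ≤ f i + 2 ∧ f i + 2 ≤ hi + δ then (f i + 2).choose δ else 0)))
    (h₀ : ∑ i ∈ s, ∑ j ∈ range (m₀ + 1), Nat.choose m₀ j *
        (if lo ≤ x i + min j 3 ∧ x i + min j 3 ≤ hi ∧ Θ ≤ (f i + min (m₀ - j) 3) + (x i + min j 3) then
          (f i + min (m₀ - j) 3).choose δ else 0) ≤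
      ∑ i ∈ s, ∑ j ∈ range (m₀ + 1), Nat.choose m₀ j *
        (if lo + δ ≤ f i + min (m₀ - j) 3 ∧ f i + min (m₀ - j) 3 ≤ hi + δ then (f i + min (m₀ - j) 3).choose δ else 0)) :
    ∑ i ∈ s, ∑ j ∈ range (m + 1), Nat.choose m j *
        (if lo ≤ x i + min j 3 ∧ x i + min j 3 ≤ hi ∧ Θ ≤ (f i + min (m - j) 3) + (x i + min j 3) then
          (f i + min (m - j) 3).choose δ else 0) ≤
      ∑ i ∈ s, ∑ j ∈ range (m + 1), Nat.choose m j *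
        (if lo + δ ≤ f i + min (m - j) 3 ∧ f i + min (m - j) 3 ≤ hi + δ then (f i + min (m - j) 3).choose δ else 0) := by
  -- the preservers `T₂₃` and `δ₃₃` (the `(1,1)`-shift twice, then `coloop` / `shift11`)
  have h11 : ∀ lo hi δ Θ : ℕ, Θ ≤ lo + hi + δ → (lo = 0 ∨ lo + hi + δ ≤ Θ) →
      ∑ i ∈ s, (if lo ≤ x i + 1 ∧ x i + 1 ≤ hi ∧ Θ ≤ (f i + 1) + (x i + 1) then (f i + 1).choose δ else 0) ≤
        ∑ i ∈ s, (if lo + δ ≤ f i + 1 ∧ f i + 1 ≤ hi + δ then (f i + 1).choose δ else 0) :=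
    fun lo hi δ Θ h1 h2 => PLDClosure.shift11 s x f hPLD lo hi δ Θ h1 h2
  have h22 : ∀ lo hi δ Θ : ℕ, Θ ≤ lo + hi + δ → (lo = 0 ∨ lo + hi + δ ≤ Θ) →
      ∑ i ∈ s, (if lo ≤ x i + 2 ∧ x i + 2 ≤ hi ∧ Θ ≤ (f i + 2) + (x i + 2) then (f i + 2).choose δ else 0) ≤
        ∑ i ∈ s, (if lo + δ ≤ f i + 2 ∧ f i + 2 ≤ hi + δ then (f i + 2).choose δ else 0) :=
    fun lo hi δ Θ h1 h2 => PLDClosure.shift11 s (fun i => x i + 1) (fun i => f i + 1) h11 lo hi δ Θ h1 h2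
  have hT : ∑ i ∈ s, ((if lo ≤ x i + 2 ∧ x i + 2 ≤ hi ∧ Θ ≤ (f i + 3) + (x i + 2) then (f i + 3).choose δ else 0) +
        (if lo ≤ x i + 3 ∧ x i + 3 ≤ hi ∧ Θ ≤ (f i + 2) + (x i + 3) then (f i + 2).choose δ else 0)) ≤
      ∑ i ∈ s, ((if lo + δ ≤ f i + 3 ∧ f i + 3 ≤ hi + δ then (f i + 3).choose δ else 0) +
        (if lo + δ ≤ f i + 2 ∧ f i + 2 ≤ hi + δ then (f i + 2).choose δ else 0)) :=
    PLDClosure.coloop s (fun i => x i + 2) (fun i => f i + 2) h22 lo hi δ Θ hΘ hlo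
  have hS : ∑ i ∈ s, (if lo ≤ x i + 3 ∧ x i + 3 ≤ hi ∧ Θ ≤ (f i + 3) + (x i + 3) then (f i + 3).choose δ else 0) ≤
      ∑ i ∈ s, (if lo + δ ≤ f i + 3 ∧ f i + 3 ≤ hi + δ then (f i + 3).choose δ else 0) :=
    PLDClosure.shift11 s (fun i => x i + 2) (fun i => f i + 2) h22 lo hi δ Θ hΘ hlo
  -- the seven layers, for `m` and for `m₀`
  have hLm : ∀ n : ℕ, 5 ≤ n → ∀ i ∈ s, ∑ j ∈ range (n + 1), Nat.choose n j *
        (if lo ≤ x i + min j 3 ∧ x i + min j 3 ≤ hi ∧ Θ ≤ (f i + min (n - j) 3) + (x i + min j 3) then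
          (f i + min (n - j) 3).choose δ else 0) =
      (if lo ≤ x i ∧ x i ≤ hi ∧ Θ ≤ (f i + 3) + x i then (f i + 3).choose δ else 0) +
        n * (if lo ≤ x i + 1 ∧ x i + 1 ≤ hi ∧ Θ ≤ (f i + 3) + (x i + 1) then (f i + 3).choose δ else 0) +
        n.choose 2 * (if lo ≤ x i + 2 ∧ x i + 2 ≤ hi ∧ Θ ≤ (f i + 3) + (x i + 2) then (f i + 3).choose δ else 0) +
        (∑ i ∈ Ico 3 (n - 2), n.choose i) *
          (if lo ≤ x i + 3 ∧ x i + 3 ≤ hi ∧ Θ ≤ (f i + 3) + (x i + 3) then (f i + 3).choose δ else 0) +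
        n.choose 2 * (if lo ≤ x i + 3 ∧ x i + 3 ≤ hi ∧ Θ ≤ (f i + 2) + (x i + 3) then (f i + 2).choose δ else 0) +
        n * (if lo ≤ x i + 3 ∧ x i + 3 ≤ hi ∧ Θ ≤ (f i + 1) + (x i + 3) then (f i + 1).choose δ else 0) +
        (if lo ≤ x i + 3 ∧ x i + 3 ≤ hi ∧ Θ ≤ f i + (x i + 3) then (f i).choose δ else 0) :=
    fun n hn i _ => sum_choose_min_three n hn
      (fun a b => if lo ≤ x i + a ∧ x i + a ≤ hi ∧ Θ ≤ (f i + b) + (x i + a) then (f i + b).choose δ else 0)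
  have hRm : ∀ n : ℕ, 5 ≤ n → ∀ i ∈ s, ∑ j ∈ range (n + 1), Nat.choose n j *
        (if lo + δ ≤ f i + min (n - j) 3 ∧ f i + min (n - j) 3 ≤ hi + δ then (f i + min (n - j) 3).choose δ else 0) =
      (if lo + δ ≤ f i + 3 ∧ f i + 3 ≤ hi + δ then (f i + 3).choose δ else 0) +
        n * (if lo + δ ≤ f i + 3 ∧ f i + 3 ≤ hi + δ then (f i + 3).choose δ else 0) +
        n.choose 2 * (if lo + δ ≤ f i + 3 ∧ f i + 3 ≤ hi + δ then (f i + 3).choose δ else 0) +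
        (∑ i ∈ Ico 3 (n - 2), n.choose i) * (if lo + δ ≤ f i + 3 ∧ f i + 3 ≤ hi + δ then (f i + 3).choose δ else 0) +
        n.choose 2 * (if lo + δ ≤ f i + 2 ∧ f i + 2 ≤ hi + δ then (f i + 2).choose δ else 0) +
        n * (if lo + δ ≤ f i + 1 ∧ f i + 1 ≤ hi + δ then (f i + 1).choose δ else 0) +
        (if lo + δ ≤ f i ∧ f i ≤ hi + δ then (f i).choose δ else 0) :=
    fun n hn i _ => sum_choose_min_three n hn
      (fun _ b => if lo + δ ≤ f i + b ∧ f i + b ≤ hi + δ then (f i + b).choose δ else 0)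
  rw [sum_congr rfl (hLm m (hm₀.trans hm)), sum_congr rfl (hRm m (hm₀.trans hm))]
  rw [sum_congr rfl (hLm m₀ hm₀), sum_congr rfl (hRm m₀ hm₀)] at h₀
  simp only [sum_add_distrib, ← mul_sum] at h₀ hq ⊢
  rw [sum_add_distrib, sum_add_distrib] at hT
  -- the coefficients
  obtain ⟨k, hk⟩ := Nat.exists_eq_add_of_le hm
  obtain ⟨k', hk'⟩ := Nat.exists_eq_add_of_le (sum_choose_mid3_mono m₀ m hm)
  have hC := two_mul_choose_two_sub m₀ m hm
  obtain ⟨u, hu⟩ : ∃ u, m + m₀ - 1 = 9 + u := ⟨m + m₀ - 10, by omega⟩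
  rw [hu, show m - m₀ = k by omega] at hC
  rw [hk']
  rw [hk] at hC ⊢
  exact lift_alg _ _ _ _ _ _ _ _ _ _ _ _ _ _ _ _ _ _ _ _ _ hC h₀ hq hT hS

end PLDPlaneLift

end PercRepro
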